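import Summits.BirchSwinnertonDyer.BirchSwinnertonDyer.Theorems.ErratumRoadFiveNonSurjCornerHybridThreeSplit
import Summits.BirchSwinnertonDyer.BirchSwinnertonDyer.Theorems.ErratumRoadFiveNonSurjCornerKolyZShallow
import Literature.NumberTheory.GaloisCohomology.PoitouTateNumberField
import Literature.NumberTheory.EllipticCurves.QuadraticTwistLocalDataAtTwoHoldsProofs
import HarnessLib

/-!
# Route `ErratumRoadFive` (rung K2), crux `NonSurjCorner` (item stmt-BirchSwinnertonDyer-19065), registered line `Lines/hybrid.lean` r1′:
# TWO OF THE ELEVEN NAMED INPUTS OF `stub_cornerShimuraFacts57` ARE THEOREMS OF THE TREE — the hybrid glue with them DISCHARGED, and the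
# glue keyed to the DEEP locus of `stub_kolyZ57`
# (cell `bsd-stepL`, seat `bsd-stepL-corner-p1` g14; `--supports stmt-BirchSwinnertonDyer-19065 --as helper`)

WHY THIS FILE. The registered composition `Cruxes/NonSurjCorner/Lines/hybrid.lean` r1′ (planner g38, RULING 44) feeds the seat's glue #3
`nonSurjCorner_of_kolyZ_of_twinMuAn_of_katoFacts_of_lowerX11a_of_namedFacts_of_savedDisplay_of_threeSplit` (p587691) with the structured
stub `stub_cornerShimuraFacts57` = 3 named facts of the X₀(N) MAX form ∧ 8 named inputs of the Shimura roads. Two of those eight are PROVED in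
the tree and need not be cited at all:
* the Poitou–Tate sum formula `∀ K, poitouTate_sum_localTatePairing_eq_zero K` = `poitouTate_sum_localTatePairing_eq_zero_holds`
  (`Literature/NumberTheory/GaloisCohomology/PoitouTateNumberField.lean`, Milne ADT I 4.10 (b), every number field);
* Barrios et al.'s `c₂ ∈ {…}` for quadratic twists at a prime of good reduction `localTamagawaNumber_quadraticTwist_two_mem_of_goodReduction` =
  `BarriosEtAl2025.localTamagawaNumber_quadraticTwist_two_mem_of_goodReduction_holds` (`…/QuadraticTwistLocalDataAtTwoHoldsProofs.lean`).
(For the record, three conjuncts of the registered support child `KatoTwinFactsFiveAn` (19949) are likewise tree theorems —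
`heegnerPointOfConductor_one_galoisConj_holds`, `phi_heegnerTau_mem_singularModuliField_holds`, `Kato2004.nonempty_iwasawaH1Data_holds` — but
19949 is consumed BY NAME and is re-typed only by the planner.)

* §1 **glue #4 `…_of_sixNamedInputs_of_savedDisplay_of_threeSplit`** — glue #3 with the Shimura-road bundle cut from eight names to SIX
  (`hShim6`); the two discharged inputs are supplied inside the proof by the tree theorems. Candidate r2 of `stub_cornerShimuraFacts57`.
* §2 **glue #5 `…_of_kolyZDeep_…`** — glue #4 with the child `NonSurjCornerKolyZ` (19946 = `stub_kolyZ57`) replaced by its DEEP-locus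
  restriction `hZdeep` (the seat's `Theorems.nonSurjCornerKolyZ_of_deep'`, p590794 ∕ its §5 append: shallow frames closed in the kernel,
  Darmon 3.6 and Shimura reciprocity discharged): the line's open Kolyvagin input displayed at its honest size.

HONEST FRAMING: THEOREMS ONLY (no definition, no named fact minted, no `sorry`, axioms the standard trio); CONDITIONAL on every displayed
binder (OPEN: 19946 resp. its deep locus, 19948, 19064, lane B's `Theorems.ShimuraInertSavedDisplayAt`, the residual `hres3`; UNPROVED named
facts: the 3 + 6 listed); item 19065 is NOT closed; nothing about any curve's BSD; BSD is not advanced; no census word moves (T7).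
References (locators only): [cite: MilneADT2006, Ch. I, Thm. 4.10(b)] [cite: Cha2005, Thm. 21 and Rmk. 25] [cite: JetchevSkinnerWan2017, §7.4.2]
[cite: GrossLMS1991, Prop. 3.7 (2)] [cite: McCallumLMS1991, §5 (p. 303)].
-/

set_option autoImplicit false
set_option linter.dupNamespace false -- `Summit.BirchSwinnertonDyer.BirchSwinnertonDyer` (summit = problem), tree-wide

noncomputable section

open scoped Classical NumberField MatrixGroups ModularForm

namespace Summit.BirchSwinnertonDyer.BirchSwinnertonDyer.Theorems

open CongruenceSubgroup WeierstrassCurve NumberField IsDedekindDomain Field Rat.HeightOneSpectrum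
  Literature.NumberTheory.EllipticCurves
  Literature.NumberTheory.EllipticCurves.ModularForms
  Literature.NumberTheory.EllipticCurves.Rank1Residual
  Literature.NumberTheory.EllipticCurves.Rank1Residual.Typed
  Literature.NumberTheory.EllipticCurves.Wuthrich2014
  Literature.NumberTheory.EllipticCurves.SteinWuthrich2013
  Literature.NumberTheory.EllipticCurves.Greenberg1999
  Literature.NumberTheory.EllipticCurves.Kato2004
  Literature.NumberTheory.EllipticCurves.BarriosEtAl2025
  Literature.NumberTheory.GaloisRepresentations Literature.NumberTheory.GaloisCohomology
  Literature.NumberTheory.Automorphic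
  Summit.BirchSwinnertonDyer.Rank1Residual
  Summit.BirchSwinnertonDyer.Rank1Residual.X11b
  Summit.BirchSwinnertonDyer.Rank1Residual.X11b.Three.Koly

/-! ### §1 Glue #4: the Shimura-road bundle cut to six names -/

/-- **THE HYBRID GLUE WITH SIX (not eight) NAMED SHIMURA-ROAD INPUTS.** `NonSurjCornerKolyZ` (19946) → `NonSurjCornerTwinMuAn` (19948) →
`KatoTwinFactsFiveAn` (19949) → `X11aLowerHalf` (19950 ∕ 19064) → hMax (3 names) → **hShim6** {Friedberg–Hoffstein inert twist, Jacquet–Langlands ∕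
Shimura parametrisation data, Pasten 2024 component orders, `casselsTate_levelInputs`, the CM-point primitives at inert `p` and at split `p`} →
the SAVED display (lane B's OPEN typed object) → `hres3` («three further split multiplicative primes») → `NonSurjCorner`. The Poitou–Tate sum
formula and Barrios et al.'s `c₂` input of glue #3 are supplied by the TREE THEOREMS `poitouTate_sum_localTatePairing_eq_zero_holds` and
`BarriosEtAl2025.localTamagawaNumber_quadraticTwist_two_mem_of_goodReduction_holds`. CONDITIONAL on every binder; 19065 NOT closed; T7.
[cite: MilneADT2006, Ch. I, Thm. 4.10(b)] [cite: Cha2005, Thm. 21 and Rmk. 25] [cite: JetchevSkinnerWan2017, §7.4.2] -/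
theorem nonSurjCorner_of_kolyZ_of_twinMuAn_of_katoFacts_of_lowerX11a_of_sixNamedInputs_of_savedDisplay_of_threeSplit
    (hZ : NonSurjCornerKolyZ) (hμ : NonSurjCornerTwinMuAn)
    (hF : Summit.BirchSwinnertonDyer.BirchSwinnertonDyer.Theses.ErratumRoadFive.KatoTwinFactsFiveAn)
    (h₄ : Summit.BirchSwinnertonDyer.BirchSwinnertonDyer.Theses.ErratumRoadFive.X11aLowerHalf)
    -- the three named facts of the X₀(N) Kolyvagin road (MAX form)
    (hMax : GrossLMS1991.prop37_2_frobeniusCongruence ∧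
      (∀ (K : Type) [Field K] [NumberField K], poitouTate_selmerStructure_duality_conj K) ∧
      Gross1991_heegnerPoint_sub_ratTorsion_mem_E0_imageFree)
    -- the SIX still-unproved named inputs of the Shimura roads (inert `p`, split `p`, saving)
    (hShim6 : friedbergHoffstein_exists_twist_ne_zero_inertAt ∧ nonempty_shimuraParametrizationData ∧
      PastenShimura2024_componentOrders ∧
      (∀ (K : Type) [Field K] [NumberField K], casselsTate_levelInputs K) ∧
      shimuraCurve_heegnerSystem_primitivesFromFiveIrr ∧ shimuraCurve_heegnerSystem_primitivesSplitReduced)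
    -- the SAVED inert display at the corner pairs (OPEN typed object, lane B corner3-p2 g6)
    (hSav : ∀ (W : WeierstrassCurve ℚ) [W.IsElliptic] [W.IsGloballyMinimal] (p : ℕ) [Fact p.Prime],
      ClassX11b W p → ¬ Surj W p → (p = 5 ∨ p = 7) → ∀ (q₁ : ℕ) [Fact q₁.Prime], ShimuraInertSavedDisplayAt W p q₁)
    -- the ONE structural residual, clean shape: three further split multiplicative primes
    (hres3 : ∀ (W : WeierstrassCurve ℚ) [W.IsElliptic] [W.IsGloballyMinimal] (p : ℕ) [Fact p.Prime],
      ClassX11b W p → ¬ Surj W p → (p = 5 ∨ p = 7) → p ∣ padicValInt p W.minimalDiscriminantInt → ¬ Ram W p →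
      ∀ (q₁ q₂ q₃ : ℕ) [Fact q₁.Prime] [Fact q₂.Prime] [Fact q₃.Prime], q₁ ≠ p → q₂ ≠ p → q₃ ≠ p →
      q₁ ≠ q₂ → q₁ ≠ q₃ → q₂ ≠ q₃ →
      W.HasSplitMultiplicativeReductionAtPrime q₁ → W.HasSplitMultiplicativeReductionAtPrime q₂ →
      W.HasSplitMultiplicativeReductionAtPrime q₃ → Typed.MissingUpperBoundAt W p) :
    Summit.BirchSwinnertonDyer.BirchSwinnertonDyer.Theses.ErratumRoadFive.NonSurjCorner := by
  obtain ⟨hFH, hJL, hCO, hCT, hLab, hLabS⟩ := hShim6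
  exact nonSurjCorner_of_kolyZ_of_twinMuAn_of_katoFacts_of_lowerX11a_of_namedFacts_of_savedDisplay_of_threeSplit hZ hμ hF h₄
    hMax ⟨hFH, hJL, hCO, poitouTate_sum_localTatePairing_eq_zero_holds, hCT, hLab, hLabS,
      BarriosEtAl2025.localTamagawaNumber_quadraticTwist_two_mem_of_goodReduction_holds⟩ hSav hres3

/-! ### §2 Glue #5: the Kolyvagin child at its deep locus -/

/-- **THE HYBRID GLUE KEYED TO THE DEEP LOCUS OF `stub_kolyZ57`.** As glue #4, but the child `NonSurjCornerKolyZ` (19946) is replaced by its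
restriction `hZdeep` to the DEEP corner frames — the frames carrying a conductor-1 Kolyvagin–Heegner datum whose bottom point, read in `E(K)`,
lies in `p^{t+1} E(K)`, `t = ord_p ∏ c_ℓ` (predicted by Gross–Zagier + BSD: `Ш(E/K)[p] ≠ 0` or `p ∣ c_Manin`); the shallow frames are closed
in the kernel by `Theorems.nonSurjCornerKolyZ_of_deep'` (conductor-1 certificate at depth `t`; Darmon 2004 Thm. 3.6 and Shimura reciprocity at
conductor 1 DISCHARGED by tree theorems). Inputs: `hZdeep` (OPEN: Kolyvagin's conjecture proper, refined form, at a non-surjective irreducible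
image and `p ∥ N`) → 19948 → 19949 → 19950 → hMax (3) → hShim6 (6) → hSav → hres3 → `NonSurjCorner`. CONDITIONAL on every binder; nothing
booked; 19065 NOT closed; T7. [cite: McCallumLMS1991, §5 (p. 303), Cor. 5.6 (p. 310)] [cite: Cha2005, Thm. 21 and Rmk. 25] -/
theorem nonSurjCorner_of_kolyZDeep_of_twinMuAn_of_katoFacts_of_lowerX11a_of_sixNamedInputs_of_savedDisplay_of_threeSplit
    (hZdeep : ∀ (W : WeierstrassCurve ℚ) [W.IsElliptic] [W.IsGloballyMinimal] (p : ℕ) [Fact p.Prime]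
      (N : ℕ) [NeZero N] (K : Type) [Field K] [NumberField K]
      (Dt : ModularParametrizationData W N) (β : ℤ) (ι : K →+* ℂ),
      ClassX11b W p → ¬ Surj W p → (p = 5 ∨ p = 7) → p ∣ padicValInt p W.minimalDiscriminantInt →
      ¬ Ram W p → W.conductorNorm ℤ = N → IsImaginaryQuadratic K →
      4 < (NumberField.discr K).natAbs → SatisfiesHeegnerHypothesis N K →
      SatisfiesHeegnerHypothesis p K → (4 * (N : ℤ)) ∣ β ^ 2 - NumberField.discr K → ¬ (p : ℤ) ∣ Dt.c →
      (∃ (d₁ : KolyvaginHeegnerData Dt β ι 1) (y : (W.baseChange K).toAffine.Point),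
        WeierstrassCurve.Affine.Point.map (W' := W) (algebraMap K (ringClassField K ι 1)).toRatAlgHom y =
          d₁.derivedPoint ∧
        ∃ Q : (W.baseChange K).toAffine.Point, ((p ^ (padicValNat p W.tamagawaProduct + 1) : ℕ) : ℤ) • Q = y) →
      ∃ M : ℕ, M ≤ padicValNat p W.tamagawaProduct ∧ CertificateAt Dt β ι p M)
    (hμ : NonSurjCornerTwinMuAn)
    (hF : Summit.BirchSwinnertonDyer.BirchSwinnertonDyer.Theses.ErratumRoadFive.KatoTwinFactsFiveAn)
    (h₄ : Summit.BirchSwinnertonDyer.BirchSwinnertonDyer.Theses.ErratumRoadFive.X11aLowerHalf)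
    (hMax : GrossLMS1991.prop37_2_frobeniusCongruence ∧
      (∀ (K : Type) [Field K] [NumberField K], poitouTate_selmerStructure_duality_conj K) ∧
      Gross1991_heegnerPoint_sub_ratTorsion_mem_E0_imageFree)
    (hShim6 : friedbergHoffstein_exists_twist_ne_zero_inertAt ∧ nonempty_shimuraParametrizationData ∧
      PastenShimura2024_componentOrders ∧
      (∀ (K : Type) [Field K] [NumberField K], casselsTate_levelInputs K) ∧
      shimuraCurve_heegnerSystem_primitivesFromFiveIrr ∧ shimuraCurve_heegnerSystem_primitivesSplitReduced)
    (hSav : ∀ (W : WeierstrassCurve ℚ) [W.IsElliptic] [W.IsGloballyMinimal] (p : ℕ) [Fact p.Prime],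
      ClassX11b W p → ¬ Surj W p → (p = 5 ∨ p = 7) → ∀ (q₁ : ℕ) [Fact q₁.Prime], ShimuraInertSavedDisplayAt W p q₁)
    (hres3 : ∀ (W : WeierstrassCurve ℚ) [W.IsElliptic] [W.IsGloballyMinimal] (p : ℕ) [Fact p.Prime],
      ClassX11b W p → ¬ Surj W p → (p = 5 ∨ p = 7) → p ∣ padicValInt p W.minimalDiscriminantInt → ¬ Ram W p →
      ∀ (q₁ q₂ q₃ : ℕ) [Fact q₁.Prime] [Fact q₂.Prime] [Fact q₃.Prime], q₁ ≠ p → q₂ ≠ p → q₃ ≠ p →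
      q₁ ≠ q₂ → q₁ ≠ q₃ → q₂ ≠ q₃ →
      W.HasSplitMultiplicativeReductionAtPrime q₁ → W.HasSplitMultiplicativeReductionAtPrime q₂ →
      W.HasSplitMultiplicativeReductionAtPrime q₃ → Typed.MissingUpperBoundAt W p) :
    Summit.BirchSwinnertonDyer.BirchSwinnertonDyer.Theses.ErratumRoadFive.NonSurjCorner :=
  nonSurjCorner_of_kolyZ_of_twinMuAn_of_katoFacts_of_lowerX11a_of_sixNamedInputs_of_savedDisplay_of_threeSplit
    (nonSurjCornerKolyZ_of_deep' hZdeep) hμ hF h₄ hMax hShim6 hSav hres3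

end Summit.BirchSwinnertonDyer.BirchSwinnertonDyer.Theorems

end
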